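import Literature.NumberTheory.GaloisRepresentations.LubinTateColemanLogDerivDense
import HarnessLib

/-!
# Coleman's logarithmic derivative attains every `𝒮`-eigenseries at `q = 2`: the `(π, X)`-adic limit
# (de Shalit I §3.12 Corollary)

De Shalit, *Iwasawa theory of elliptic curves with complex multiplication* (1987), Ch. I §3.12 Corollary: "`δ`
maps `{𝒩g = g^φ}` ONTO `{𝒮h = h^φ}`".  For `f = πX + X²` over a local field `F` with `|𝓀_F| = 2` and a uniformiser
congruent to a natural number modulo `π²` (e.g. `F = ℚ₂`, any `π`), this file completes the successive
approximation of `LubinTateColemanLogDerivDense.lean` to an EXACT preimage: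

* `adicFilt π j` — the `(π, X)`-adic filtration `I_j = {V : coeff_k V ∈ (π^{j-k})}` of `𝒪[F]⟦X⟧` (ideal;
  `I_a I_b ⊆ I_{a+b}`; `g ≡ 1 (mod I_1) ⟹ g^{2^N} ≡ 1 (mod I_{N+1})`; `t ∈ I_j ⟹ t' ∈ I_{j-1}`; `⋂ I_N = 0`);
* `approxSeq` — the coherent sequence `G_{N+1} = G_N · g_N^{m₁^{N+1}}` of `𝒩`-invariant principal units with
  `h ≡ δG_N (mod π^{N+1})`, and `G_{N+1} − G_N ∈ I_{N+2}`;
* ★★★ `exists_logDeriv_eq_of_colemanTrace_eq` — **`𝒮h = π h ⟹ ∃` a principal unit `G` with `δG = h`**, `G` the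
  limit of the `G_N` (`G − G_N ∈ I_{N+1}`).

What is not in this file: `𝒩G = G` for the limit `G` (continuity of `𝒩`, or the point characterisation of `ℳ_f`
via `evalAt_ltSMul_colemanNorm` + `norm_evalAt_sub_le_of_forall_lt`) — with it, `δ : ℳ_f¹ → 𝓔_π` is onto.
Everything here is proved (0 sorry).

## References

* E. de Shalit, *Iwasawa theory of elliptic curves with complex multiplication* (1987), Ch. I §3.12 Corollary. [deShalit1987]
-/

noncomputable section

open scoped PowerSeries.WithPiTopology

namespace Literature.NumberTheory.GaloisRepresentations
/-- `π² ∣ π − m ⟹ π^{N+1} ∣ π^N − m^N` (`N ≥ 1`). [folklore] -/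
private theorem pow_succ_dvd_pow_sub_pow' {R : Type*} [CommRing R] {ϖ m : R} (h : ϖ ^ 2 ∣ ϖ - m) (N : ℕ) (hN : 1 ≤ N) :
    ϖ ^ (N + 1) ∣ ϖ ^ N - m ^ N := by
  have hm : ϖ ∣ m := by
    obtain ⟨c, hc⟩ := h
    exact ⟨1 - ϖ * c, by linear_combination -hc⟩
  induction N, hN using Nat.le_induction with
  | base => simpa using h
  | succ N hN ih =>
    have e : ϖ ^ (N + 1) - m ^ (N + 1) = ϖ * (ϖ ^ N - m ^ N) + (ϖ - m) * m ^ N := by ring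
    rw [e, pow_succ']
    refine dvd_add (mul_dvd_mul (dvd_refl ϖ) ih) ?_
    have h2 : ϖ ^ 2 * ϖ ^ N ∣ (ϖ - m) * m ^ N := mul_dvd_mul h (pow_dvd_pow_of_dvd hm N)
    have e2 : ϖ * ϖ ^ (N + 1) = ϖ ^ 2 * ϖ ^ N := by ring
    rw [e2]
    exact h2

/-- `a ∈ (s)`, `G ∈ coeffIdeal (t)` ⟹ `C a · G ∈ coeffIdeal (s t)`. [folklore] -/
private theorem C_mul_mem_coeffIdeal_span_mul' {A : Type*} [CommRing A] {a s t : A} (ha : a ∈ Ideal.span {s})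
    {G : PowerSeries A} (hG : G ∈ LubinTate.coeffIdeal (Ideal.span {t})) :
    PowerSeries.C a * G ∈ LubinTate.coeffIdeal (Ideal.span {s * t}) := by
  intro k
  rw [PowerSeries.coeff_C_mul, ← Ideal.span_singleton_mul_span_singleton]
  exact Ideal.mul_mem_mul ha (hG k)
end Literature.NumberTheory.GaloisRepresentations

/-! ## The limit: Coleman's `δ` attains every `𝒮`-eigenseries (q = 2) — de Shalit I §3.12 Corollary -/

namespace Literature.NumberTheory.GaloisRepresentations

section LocalFieldLimit

open GaloisRepresentations.IsNonarchimedeanLocalField LubinTate ValuativeRel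

variable (F : Type*) [Field F] [ValuativeRel F] [TopologicalSpace F] [IsNonarchimedeanLocalField F]

attribute [local instance] ltNormUniformSpace ltNormIsUniformAddGroup rk1 nF nE fintypeResidueField

variable {F}
variable {π : 𝒪[F]} (hπ : (valuation F).IsUniformizer (π : F)) (n : ℕ)

/-! ### The `(π, X)`-adic filtration in coefficient form -/

variable (π) in
/-- `I_j = {V : coeff_k V ∈ (π^{j-k}) for all k}` — the `j`-th power of the ideal `(π, X)` of `𝒪[F]⟦X⟧`,
coefficientwise. [cite: deShalit1987, Ch. I §3.12 Corollary (proof)] -/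
def adicFilt (j : ℕ) : Ideal (PowerSeries (LTCoeff F)) where
  carrier := {V | ∀ k, PowerSeries.coeff k V ∈ Ideal.span {LTCoeff.of F π ^ (j - k)}}
  add_mem' {a b} ha hb k := by rw [map_add]; exact add_mem (ha k) (hb k)
  zero_mem' k := by rw [map_zero]; exact zero_mem _
  smul_mem' c V hV k := by
    rw [smul_eq_mul, PowerSeries.coeff_mul]
    refine Ideal.sum_mem _ fun x hx => ?_
    have hx' := Finset.mem_antidiagonal.mp hx
    refine Ideal.mul_mem_left _ _ (Ideal.mem_span_singleton.mpr ?_)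
    exact dvd_trans (pow_dvd_pow _ (by omega)) (Ideal.mem_span_singleton.mp (hV x.2))

omit [TopologicalSpace F] [IsNonarchimedeanLocalField F] in
/-- Membership in `I_j` (unfolding). [cite: deShalit1987, Ch. I §3.12 Corollary (proof)] -/
theorem mem_adicFilt {j : ℕ} {V : PowerSeries (LTCoeff F)} :
    V ∈ adicFilt π j ↔ ∀ k, PowerSeries.coeff k V ∈ Ideal.span {LTCoeff.of F π ^ (j - k)} := Iff.rfl

omit [TopologicalSpace F] [IsNonarchimedeanLocalField F] in
/-- `I_a ⊆ I_b` for `b ≤ a`. [cite: deShalit1987, Ch. I §3.12 Corollary (proof)] -/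
theorem adicFilt_mono {a b : ℕ} (hab : b ≤ a) : adicFilt π a ≤ adicFilt π b := fun V hV k =>
  Ideal.mem_span_singleton.mpr (dvd_trans (pow_dvd_pow _ (by omega)) (Ideal.mem_span_singleton.mp (hV k)))

omit [TopologicalSpace F] [IsNonarchimedeanLocalField F] in
/-- `I_a · I_b ⊆ I_{a+b}`. [cite: deShalit1987, Ch. I §3.12 Corollary (proof)] -/
theorem mul_mem_adicFilt {a b : ℕ} {U V : PowerSeries (LTCoeff F)} (hU : U ∈ adicFilt π a) (hV : V ∈ adicFilt π b) :
    U * V ∈ adicFilt π (a + b) := by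
  intro k
  rw [PowerSeries.coeff_mul]
  refine Ideal.sum_mem _ fun x hx => ?_
  have hx' := Finset.mem_antidiagonal.mp hx
  obtain ⟨c, hc⟩ := Ideal.mem_span_singleton.mp (hU x.1)
  obtain ⟨d, hd⟩ := Ideal.mem_span_singleton.mp (hV x.2)
  rw [hc, hd, Ideal.mem_span_singleton]
  refine dvd_trans (pow_dvd_pow _ (by omega : a + b - k ≤ (a - x.1) + (b - x.2))) ?_
  rw [pow_add]
  exact mul_dvd_mul (dvd_mul_right _ _) (dvd_mul_right _ _)

omit [TopologicalSpace F] [IsNonarchimedeanLocalField F] in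
/-- `coeffIdeal (π^j) ⊆ I_j`. [cite: deShalit1987, Ch. I §3.12 Corollary (proof)] -/
theorem mem_adicFilt_of_mem_coeffIdeal {j : ℕ} {V : PowerSeries (LTCoeff F)}
    (hV : V ∈ coeffIdeal (Ideal.span {LTCoeff.of F π ^ j})) : V ∈ adicFilt π j := fun k =>
  Ideal.mem_span_singleton.mpr (dvd_trans (pow_dvd_pow _ (by omega)) (Ideal.mem_span_singleton.mp (hV k)))

omit [TopologicalSpace F] [IsNonarchimedeanLocalField F] in
/-- `u - 1 ∈ I_j ⟹ u^r - 1 ∈ I_j`. [cite: deShalit1987, Ch. I §3.12 Corollary (proof)] -/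
theorem pow_sub_one_mem_adicFilt {j : ℕ} {u : PowerSeries (LTCoeff F)} (hu : u - 1 ∈ adicFilt π j) (r : ℕ) :
    u ^ r - 1 ∈ adicFilt π j := by
  obtain ⟨c, hc⟩ := sub_dvd_pow_sub_pow u 1 r
  rw [one_pow] at hc
  rw [hc]
  exact Ideal.mul_mem_right _ _ hu

include hπ in
/-- `t ∈ I_j`, `j ≥ 1` ⟹ `(1 + t)² - 1 ∈ I_{j+1}` (as `2 ∈ (π)` when `|𝓀_F| = 2`).
[cite: deShalit1987, Ch. I §3.12 Corollary (proof)] -/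
theorem sq_sub_one_mem_adicFilt (hq : residueFieldCard F = 2) {j : ℕ} (hj : 1 ≤ j) {t : PowerSeries (LTCoeff F)}
    (ht : t ∈ adicFilt π j) : (1 + t) ^ 2 - 1 ∈ adicFilt π (j + 1) := by
  obtain ⟨u, hu⟩ := exists_two_eq_pi_mul hπ hq
  have e : (1 + t) ^ 2 - 1 = PowerSeries.C (LTCoeff.of F π) * (PowerSeries.C u * t) + t * t := by
    rw [← mul_assoc, ← map_mul, ← hu, map_ofNat]; ring
  rw [e]
  refine add_mem ?_ (adicFilt_mono (by omega) (mul_mem_adicFilt ht ht))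
  have hC : PowerSeries.C (LTCoeff.of F π) ∈ adicFilt π 1 := by
    intro k
    rw [PowerSeries.coeff_C]
    split_ifs with hk
    · subst hk; rw [Nat.sub_zero, pow_one]; exact Ideal.mem_span_singleton_self _
    · exact zero_mem _
  have := mul_mem_adicFilt hC (Ideal.mul_mem_left _ (PowerSeries.C u) ht)
  rwa [add_comm] at this

include hπ in
/-- `g - 1 ∈ I_1 ⟹ g^{2^N} - 1 ∈ I_{N+1}`. [cite: deShalit1987, Ch. I §3.12 Corollary (proof)] -/
theorem pow_two_pow_sub_one_mem_adicFilt (hq : residueFieldCard F = 2) {g : PowerSeries (LTCoeff F)}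
    (hg : g - 1 ∈ adicFilt π 1) (N : ℕ) : g ^ 2 ^ N - 1 ∈ adicFilt π (N + 1) := by
  induction N with
  | zero => rwa [pow_zero, pow_one]
  | succ N ih =>
    have e : g ^ 2 ^ (N + 1) - 1 = (1 + (g ^ 2 ^ N - 1)) ^ 2 - 1 := by rw [pow_succ, pow_mul]; ring
    rw [e]
    exact sq_sub_one_mem_adicFilt hπ hq (by omega) ih

omit [TopologicalSpace F] [IsNonarchimedeanLocalField F] in
/-- A principal unit lies in `1 + I_1`. [cite: deShalit1987, Ch. I §3.12 Corollary (proof)] -/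
theorem sub_one_mem_adicFilt_one {g : PowerSeries (LTCoeff F)}
    (hg : PowerSeries.constantCoeff g - 1 ∈ Ideal.span {LTCoeff.of F π}) : g - 1 ∈ adicFilt π 1 := by
  intro k
  rcases k with _ | k
  · rw [Nat.sub_zero, pow_one, map_sub, PowerSeries.coeff_zero_eq_constantCoeff, map_one]; exact hg
  · rw [show 1 - (k + 1) = 0 by omega, pow_zero, Ideal.span_singleton_one]; exact Submodule.mem_top

omit [TopologicalSpace F] [IsNonarchimedeanLocalField F] in
/-- `t ∈ I_j ⟹ t' ∈ I_{j-1}`. [cite: deShalit1987, Ch. I §3.12 Corollary (proof)] -/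
theorem derivative_mem_adicFilt {j : ℕ} {t : PowerSeries (LTCoeff F)} (ht : t ∈ adicFilt π j) :
    PowerSeries.derivative (LTCoeff F) t ∈ adicFilt π (j - 1) := by
  intro k
  rw [PowerSeries.coeff_derivative]
  refine Ideal.mul_mem_right _ _ (Ideal.mem_span_singleton.mpr ?_)
  exact dvd_trans (pow_dvd_pow _ (by omega)) (Ideal.mem_span_singleton.mp (ht (k + 1)))

include hπ in
/-- `⋂_N I_N = 0`. [cite: deShalit1987, Ch. I §3.12 Corollary (proof)] -/
theorem eq_zero_of_forall_mem_adicFilt {V : PowerSeries (LTCoeff F)} (hV : ∀ N, V ∈ adicFilt π N) : V = 0 := by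
  ext k
  rw [map_zero]
  refine LTCoeff.eq_zero_of_forall_mem_span_pow_succ hπ fun i => ?_
  have := hV (k + i + 1) k
  rwa [show k + i + 1 - k = i + 1 by omega] at this

/-! ### The coherent approximating sequence -/

/-- Data of the `N`-th approximation: an `𝒩`-invariant principal unit `G` with `h ≡ δG (mod π^{N+1})`.
[cite: deShalit1987, Ch. I §3.12 Corollary (proof)] -/
structure ApproxData (h : PowerSeries (LTCoeff F)) (N : ℕ) where
  /-- the approximating unit -/
  G : (PowerSeries (LTCoeff F))ˣ
  /-- `𝒩 G = G` -/
  norm_eq : colemanNorm hπ n (G : PowerSeries (LTCoeff F)) = G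
  /-- `G(0) ≡ 1 (mod π)` -/
  principal : PowerSeries.constantCoeff (G : PowerSeries (LTCoeff F)) - 1 ∈ Ideal.span {LTCoeff.of F π}
  /-- `h ≡ δG (mod π^{N+1})` -/
  approx : h - logDeriv hπ G ∈ coeffIdeal (Ideal.span {LTCoeff.of F π ^ (N + 1)})

/-- **The step**: from an `N`-th approximation `G`, a principal `𝒩`-invariant `g` with `G · g^{m₁^{N+1}}` an
`(N+1)`-th approximation. [cite: deShalit1987, Ch. I §3.12 Corollary (proof)] -/
theorem exists_approx_step (hq : residueFieldCard F = 2) {m₁ : ℕ} (hm₁ : LTCoeff.of F π ^ 2 ∣ LTCoeff.of F π - m₁)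
    {h : PowerSeries (LTCoeff F)} (hh : colemanTrace hπ n h = PowerSeries.C (LTCoeff.of F π) * h) {N : ℕ}
    (d : ApproxData hπ n h N) :
    ∃ g : (PowerSeries (LTCoeff F))ˣ, colemanNorm hπ n (g : PowerSeries (LTCoeff F)) = g ∧
      PowerSeries.constantCoeff (g : PowerSeries (LTCoeff F)) - 1 ∈ Ideal.span {LTCoeff.of F π} ∧
      colemanNorm hπ n ((d.G * g ^ (m₁ ^ (N + 1)) : (PowerSeries (LTCoeff F))ˣ) : PowerSeries (LTCoeff F)) =
        (d.G * g ^ (m₁ ^ (N + 1)) : (PowerSeries (LTCoeff F))ˣ) ∧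
      PowerSeries.constantCoeff ((d.G * g ^ (m₁ ^ (N + 1)) : (PowerSeries (LTCoeff F))ˣ) : PowerSeries (LTCoeff F)) - 1 ∈
        Ideal.span {LTCoeff.of F π} ∧
      h - logDeriv hπ (d.G * g ^ (m₁ ^ (N + 1))) ∈ coeffIdeal (Ideal.span {LTCoeff.of F π ^ (N + 2)}) := by
  have hE : colemanTrace hπ n (h - logDeriv hπ d.G) = PowerSeries.C (LTCoeff.of F π) * (h - logDeriv hπ d.G) := by
    rw [colemanTrace_sub, hh, colemanTrace_logDeriv_of_colemanNorm_eq hπ n d.G d.norm_eq, mul_sub]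
  obtain ⟨hN', hhN', hEN⟩ := exists_eq_C_pow_mul_of_colemanTrace_eq hπ n (N + 1) _ hE d.approx
  obtain ⟨gN, hNgN, hgN0, hgN⟩ := exists_colemanNorm_eq_sub_logDeriv_mem hπ n hq hN' hEN
  have hmN := pow_succ_dvd_pow_sub_pow' hm₁ (N + 1) (by omega)
  refine ⟨gN, hNgN, hgN0, ?_, ?_, ?_⟩
  · have e1 : Units.map (colemanNormHom hπ n) d.G = d.G := Units.ext d.norm_eq
    have e2 : Units.map (colemanNormHom hπ n) gN = gN := Units.ext hNgN
    have e3 : Units.map (colemanNormHom hπ n) (d.G * gN ^ (m₁ ^ (N + 1))) = d.G * gN ^ (m₁ ^ (N + 1)) := by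
      rw [map_mul, map_pow, e1, e2]
    have := congrArg (fun v : (PowerSeries (LTCoeff F))ˣ => (v : PowerSeries (LTCoeff F))) e3
    simpa only [Units.coe_map, colemanNormHom_apply] using this
  · have key : ∀ x : LTCoeff F, x - 1 ∈ Ideal.span {LTCoeff.of F π} ↔
        IsLocalRing.residue 𝒪[F] ((LTCoeff.of F).symm x) = 1 := fun x => by
      rw [← residue_eq_zero_iff_mem hπ, map_sub, map_sub, map_one, map_one, sub_eq_zero]
    have hG0 := d.principal
    rw [key] at hG0 hgN0 ⊢
    rw [Units.val_mul, Units.val_pow_eq_pow_val, map_mul, map_pow, map_mul, map_pow, map_mul, map_pow, hG0,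
      hgN0, one_pow, mul_one]
  · have e : h - logDeriv hπ (d.G * gN ^ (m₁ ^ (N + 1))) =
        PowerSeries.C (LTCoeff.of F π ^ (N + 1)) * (hN' - logDeriv hπ gN) +
          PowerSeries.C (LTCoeff.of F π ^ (N + 1) - (m₁ : LTCoeff F) ^ (N + 1)) * logDeriv hπ gN := by
      have e1 : PowerSeries.C (LTCoeff.of F π ^ (N + 1) - (m₁ : LTCoeff F) ^ (N + 1)) =
          PowerSeries.C (LTCoeff.of F π ^ (N + 1)) - ((m₁ : PowerSeries (LTCoeff F))) ^ (N + 1) := by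
        rw [map_sub, map_pow (PowerSeries.C) (m₁ : LTCoeff F) (N + 1), map_natCast]
      rw [logDeriv_mul, logDeriv_pow, Nat.cast_pow, e1]
      linear_combination hhN'
    rw [e]
    refine add_mem ?_ ?_
    · have := C_mul_mem_coeffIdeal_span_mul' (Ideal.mem_span_singleton_self (LTCoeff.of F π ^ (N + 1))) hgN
      rwa [← pow_succ] at this
    · exact C_mul_mem_coeffIdeal (Ideal.mem_span_singleton.mpr hmN) _

/-- **The coherent sequence of approximations** `G_0, G_1 = G_0 g_0^{m₁}, G_2 = G_1 g_1^{m₁²}, …`.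
[cite: deShalit1987, Ch. I §3.12 Corollary (proof)] -/
noncomputable def approxSeq (hq : residueFieldCard F = 2) {m₁ : ℕ} (hm₁ : LTCoeff.of F π ^ 2 ∣ LTCoeff.of F π - m₁)
    {h : PowerSeries (LTCoeff F)} (hh : colemanTrace hπ n h = PowerSeries.C (LTCoeff.of F π) * h) :
    (N : ℕ) → ApproxData hπ n h N
  | 0 =>
    let e := exists_colemanNorm_eq_sub_logDeriv_mem hπ n hq h hh
    ⟨e.choose, e.choose_spec.1, e.choose_spec.2.1, by rw [zero_add, pow_one]; exact e.choose_spec.2.2⟩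
  | N + 1 =>
    let d := approxSeq hq hm₁ hh N
    let e := exists_approx_step hπ n hq hm₁ hh d
    ⟨d.G * e.choose ^ (m₁ ^ (N + 1)), e.choose_spec.2.2.1, e.choose_spec.2.2.2.1, e.choose_spec.2.2.2.2⟩

/-- `G_{N+1} = G_N · g_N^{m₁^{N+1}}` with `g_N` principal. [cite: deShalit1987, Ch. I §3.12 Corollary (proof)] -/
theorem approxSeq_succ (hq : residueFieldCard F = 2) {m₁ : ℕ} (hm₁ : LTCoeff.of F π ^ 2 ∣ LTCoeff.of F π - m₁)
    {h : PowerSeries (LTCoeff F)} (hh : colemanTrace hπ n h = PowerSeries.C (LTCoeff.of F π) * h) (N : ℕ) :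
    ∃ g : (PowerSeries (LTCoeff F))ˣ,
      PowerSeries.constantCoeff (g : PowerSeries (LTCoeff F)) - 1 ∈ Ideal.span {LTCoeff.of F π} ∧
      (approxSeq hπ n hq hm₁ hh (N + 1)).G = (approxSeq hπ n hq hm₁ hh N).G * g ^ (m₁ ^ (N + 1)) := by
  refine ⟨(exists_approx_step hπ n hq hm₁ hh (approxSeq hπ n hq hm₁ hh N)).choose,
    (exists_approx_step hπ n hq hm₁ hh (approxSeq hπ n hq hm₁ hh N)).choose_spec.2.1, ?_⟩
  rfl

include hπ in
/-- `m₁` is even when `π ∣ m₁` and `|𝓀_F| = 2`. [cite: deShalit1987, Ch. I §3.12 Corollary (proof)] -/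
theorem two_dvd_of_sq_dvd (hq : residueFieldCard F = 2) {m₁ : ℕ} (hm₁ : LTCoeff.of F π ^ 2 ∣ LTCoeff.of F π - m₁) :
    2 ∣ m₁ := by
  haveI := charP_two_of_residueFieldCard (F := F) hq
  have hdvd : LTCoeff.of F π ∣ (m₁ : LTCoeff F) := by
    obtain ⟨c, hc⟩ := hm₁
    exact ⟨1 - LTCoeff.of F π * c, by linear_combination -hc⟩
  have h0 : IsLocalRing.residue 𝒪[F] ((LTCoeff.of F).symm (m₁ : LTCoeff F)) = 0 :=
    (residue_eq_zero_iff_mem hπ _).mpr (Ideal.mem_span_singleton.mpr hdvd)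
  rw [map_natCast, map_natCast] at h0
  exact (CharP.cast_eq_zero_iff 𝓀[F] 2 m₁).mp h0

/-- ★ **`G_{N+1} − G_N ∈ I_{N+2}`**: the sequence is `(π, X)`-adically Cauchy.
[cite: deShalit1987, Ch. I §3.12 Corollary (proof)] -/
theorem approxSeq_succ_sub_mem (hq : residueFieldCard F = 2) {m₁ : ℕ} (hm₁ : LTCoeff.of F π ^ 2 ∣ LTCoeff.of F π - m₁)
    {h : PowerSeries (LTCoeff F)} (hh : colemanTrace hπ n h = PowerSeries.C (LTCoeff.of F π) * h) (N : ℕ) :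
    ((approxSeq hπ n hq hm₁ hh (N + 1)).G : PowerSeries (LTCoeff F)) - (approxSeq hπ n hq hm₁ hh N).G ∈
      adicFilt π (N + 2) := by
  obtain ⟨g, hg0, hG⟩ := approxSeq_succ hπ n hq hm₁ hh N
  obtain ⟨r, hr⟩ := two_dvd_of_sq_dvd hπ hq hm₁
  have key : (g : PowerSeries (LTCoeff F)) ^ (m₁ ^ (N + 1)) - 1 ∈ adicFilt π (N + 2) := by
    rw [hr, mul_pow, pow_mul]
    exact pow_sub_one_mem_adicFilt
      (pow_two_pow_sub_one_mem_adicFilt hπ hq (sub_one_mem_adicFilt_one hg0) (N + 1)) _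
  rw [hG, Units.val_mul, Units.val_pow_eq_pow_val, ← mul_sub_one]
  exact Ideal.mul_mem_left _ _ key

/-- `G_M − G_N ∈ I_{N+2}` for `N ≤ M`. [cite: deShalit1987, Ch. I §3.12 Corollary (proof)] -/
theorem approxSeq_sub_mem_of_le (hq : residueFieldCard F = 2) {m₁ : ℕ} (hm₁ : LTCoeff.of F π ^ 2 ∣ LTCoeff.of F π - m₁)
    {h : PowerSeries (LTCoeff F)} (hh : colemanTrace hπ n h = PowerSeries.C (LTCoeff.of F π) * h) {N M : ℕ}
    (hNM : N ≤ M) :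
    ((approxSeq hπ n hq hm₁ hh M).G : PowerSeries (LTCoeff F)) - (approxSeq hπ n hq hm₁ hh N).G ∈ adicFilt π (N + 2) := by
  induction M, hNM using Nat.le_induction with
  | base => rw [sub_self]; exact zero_mem _
  | succ M hNM ih =>
    have e : ((approxSeq hπ n hq hm₁ hh (M + 1)).G : PowerSeries (LTCoeff F)) - (approxSeq hπ n hq hm₁ hh N).G =
        (((approxSeq hπ n hq hm₁ hh (M + 1)).G : PowerSeries (LTCoeff F)) - (approxSeq hπ n hq hm₁ hh M).G) +
          (((approxSeq hπ n hq hm₁ hh M).G : PowerSeries (LTCoeff F)) - (approxSeq hπ n hq hm₁ hh N).G) := by ring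
    rw [e]
    exact add_mem (adicFilt_mono (by omega) (approxSeq_succ_sub_mem hπ n hq hm₁ hh M)) ih

/-! ### The limit -/

/-- ★★★ **Coleman's `δ` attains every `𝒮`-eigenseries** (de Shalit I §3.12 Corollary at `q = 2`, for
`F` with `|𝓀_F| = 2` and a uniformiser congruent to an integer mod `π²`, e.g. `F = ℚ₂`, any `π`): for every `h`
with `𝒮h = π·h` there is a principal unit `G ∈ 𝒪[F]⟦X⟧ˣ` with **`δG = h`**, obtained as the `(π, X)`-adic limit of
the `𝒩`-invariant approximations `G_N` (`G − G_N ∈ I_{N+1}` for all `N`).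
[cite: deShalit1987, Ch. I §3.12 Corollary] -/
theorem exists_logDeriv_eq_of_colemanTrace_eq (hq : residueFieldCard F = 2) {m₁ : ℕ}
    (hm₁ : LTCoeff.of F π ^ 2 ∣ LTCoeff.of F π - m₁)
    (h : PowerSeries (LTCoeff F)) (hh : colemanTrace hπ n h = PowerSeries.C (LTCoeff.of F π) * h) :
    ∃ G : (PowerSeries (LTCoeff F))ˣ,
      PowerSeries.constantCoeff (G : PowerSeries (LTCoeff F)) - 1 ∈ Ideal.span {LTCoeff.of F π} ∧
      logDeriv hπ G = h ∧
      ∀ N, (G : PowerSeries (LTCoeff F)) - (approxSeq hπ n hq hm₁ hh N).G ∈ adicFilt π (N + 1) := by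
  set Gs := fun N => ((approxSeq hπ n hq hm₁ hh N).G : PowerSeries (LTCoeff F)) with hGs
  -- coefficientwise limit along the shifted (Cauchy) sequences `N ↦ coeff k (G_{N+k})`
  have hcoef : ∀ k : ℕ, ∃ L : LTCoeff F, ∀ N : ℕ,
      PowerSeries.coeff k (Gs (N + k)) ≡ L [SMOD (Ideal.span {LTCoeff.of F π} ^ N • ⊤ : Submodule (LTCoeff F) (LTCoeff F))] := by
    intro k
    refine (isPrecomplete_LTCoeff hπ).prec' (fun N => PowerSeries.coeff k (Gs (N + k))) fun {M N} hMN => ?_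
    rw [SModEq.sub_mem, smul_eq_mul, Ideal.mul_top, Ideal.span_singleton_pow, ← neg_sub, neg_mem_iff, ← map_sub]
    have hmem := approxSeq_sub_mem_of_le hπ n hq hm₁ hh (show M + k ≤ N + k by omega) k
    exact Ideal.mem_span_singleton.mpr (dvd_trans (pow_dvd_pow _ (by omega)) (Ideal.mem_span_singleton.mp hmem))
  choose L hL using hcoef
  set G : PowerSeries (LTCoeff F) := PowerSeries.mk L with hGdef
  -- `G − G_N ∈ I_{N+1}`
  have hGN : ∀ N, G - Gs N ∈ adicFilt π (N + 1) := by
    intro N k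
    rw [map_sub, hGdef, PowerSeries.coeff_mk]
    rcases Nat.lt_or_ge (N + 1) k with hlt | hge
    · rw [show N + 1 - k = 0 by omega, pow_zero, Ideal.span_singleton_one]; exact Submodule.mem_top
    · -- `L_k ≡ coeff k (G_{N+1}) (mod π^{N+1-k})` and `G_{N+1} ≡ G_N (mod I_{N+2})`
      have h1 := hL k (N + 1 - k)
      rw [SModEq.sub_mem, smul_eq_mul, Ideal.mul_top, Ideal.span_singleton_pow, show N + 1 - k + k = N + 1 by omega] at h1
      have h2 := approxSeq_succ_sub_mem hπ n hq hm₁ hh N k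
      rw [map_sub, show N + 2 - k = (N + 1 - k) + 1 by omega] at h2
      have e : L k - PowerSeries.coeff k (Gs N) =
          (PowerSeries.coeff k (Gs (N + 1)) - PowerSeries.coeff k (Gs N)) - (PowerSeries.coeff k (Gs (N + 1)) - L k) := by
        ring
      rw [e]
      refine sub_mem ?_ h1
      exact Ideal.mem_span_singleton.mpr (dvd_trans (pow_dvd_pow _ (by omega)) (Ideal.mem_span_singleton.mp h2))
  -- `G` is a principal unit
  have hG0 : PowerSeries.constantCoeff G - 1 ∈ Ideal.span {LTCoeff.of F π} := by
    have h1 := hGN 0 0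
    rw [Nat.sub_zero, zero_add, pow_one, map_sub, PowerSeries.coeff_zero_eq_constantCoeff_apply,
      PowerSeries.coeff_zero_eq_constantCoeff_apply] at h1
    have h2 := (approxSeq hπ n hq hm₁ hh 0).principal
    have e : PowerSeries.constantCoeff G - 1 = (PowerSeries.constantCoeff G - PowerSeries.constantCoeff (Gs 0)) +
        (PowerSeries.constantCoeff (Gs 0) - 1) := by ring
    rw [e]
    exact add_mem h1 h2
  have hGu : IsUnit (PowerSeries.constantCoeff G) :=
    isUnit_of_sub_mem_span hπ isUnit_one (by exact hG0)
  set Gu : (PowerSeries (LTCoeff F))ˣ := (PowerSeries.isUnit_iff_constantCoeff.mpr hGu).unit with hGu_def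
  have hGuval : (Gu : PowerSeries (LTCoeff F)) = G := IsUnit.unit_spec _
  refine ⟨Gu, by rw [hGuval]; exact hG0, ?_, fun N => by rw [hGuval]; exact hGN N⟩
  -- `δ Gu = h`: for every `N`, `h − δ Gu = (h − δ G_N) − δ W_N` with `W_N − 1 ∈ I_{N+1}`, `δ W_N ∈ I_N`
  rw [eq_comm, ← sub_eq_zero]
  refine eq_zero_of_forall_mem_adicFilt hπ fun N => ?_
  set d := approxSeq hπ n hq hm₁ hh N with hd
  set W : (PowerSeries (LTCoeff F))ˣ := Gu * d.G⁻¹ with hW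
  have hGW : Gu = d.G * W := by rw [hW, mul_left_comm, mul_inv_cancel, mul_one]
  have hW1 : (W : PowerSeries (LTCoeff F)) - 1 ∈ adicFilt π (N + 1) := by
    have e : (W : PowerSeries (LTCoeff F)) - 1 = (G - Gs N) * ↑(d.G⁻¹) := by
      rw [hW, Units.val_mul, hGuval, sub_mul, hGs]
      change _ = _ - ((d.G : PowerSeries (LTCoeff F)) * ↑(d.G⁻¹))
      rw [Units.mul_inv]
    rw [e]
    exact Ideal.mul_mem_right _ _ (hGN N)
  have hδW : logDeriv hπ W ∈ adicFilt π N := by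
    rw [logDeriv_def, PowerSeries.dlog_def]
    have hd' : PowerSeries.derivative (LTCoeff F) (W : PowerSeries (LTCoeff F)) ∈ adicFilt π N := by
      have := derivative_mem_adicFilt (π := π) hW1
      rwa [map_sub, (PowerSeries.derivative (LTCoeff F)).map_one_eq_zero, sub_zero, Nat.add_sub_cancel] at this
    exact Ideal.mul_mem_left _ _ (Ideal.mul_mem_right _ _ hd')
  have e : h - logDeriv hπ Gu = (h - logDeriv hπ d.G) - logDeriv hπ W := by
    rw [hGW, logDeriv_mul]; ring
  rw [e]
  exact sub_mem (adicFilt_mono (by omega) (mem_adicFilt_of_mem_coeffIdeal d.approx)) hδW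

end LocalFieldLimit

end Literature.NumberTheory.GaloisRepresentations
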